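import Mathlib
import Summits.Ventures.HodgeRepro.Tier4.Common.TargetPositivity
import Summits.Ventures.HodgeRepro.Tier4.Common.HoloPositivityGlue
import Summits.Ventures.HodgeRepro.Tier4.Common.ConcreteWitness

/-!
# Tier4/Common/HoloPositivity — (T1) DISCHARGED: the pairing is positive definite on the holomorphic concrete
forms of `X_{Γ′}` over a fundamental domain

Blind re-derivation cell `pub-hodge-repro`, Tier 4 (README §9–§10), seat t4-typer-1 (gen 0).  Target tree path
`lean/Summits/Ventures/HodgeRepro/Tier4/Common/HoloPositivity.lean`.  Imports typer-2's
`Tier4/Common/TargetPositivity.lean` (`setIntegral_normSq_pos` for `2`-forms and its pieces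
`exists_translate_pos`, `volume_image_pos_of_inverse`, `countable_ballActions`, `actM_inv_left`), typer-1's
`HoloPositivityGlue` (`isPosDefOnHolo_of`) and `ConcreteWitness` (`IsLevel.congr`, `IsDomain.subset_ball`).

WHAT IS PROVED.  `setIntegral_normSq_pos_field`: the `1`-form twin of typer-2's theorem — a holomorphic cotangent
field `G` on the ball, invariant under `Γ′` (`pullField`), with `Σ_i ‖G_i‖²` integrable over `D` and `G` not
identically zero on the ball, has `0 < ∫_D Σ_i ‖G_i‖²` (same four steps; the invariance
`G z = (Dφ(z))ᵀ G(φ z)` transports vanishing at `φ z` to vanishing at `z` without inverting the Jacobian);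
`eq_zero_of_integral_eq_zero_2` / `_1`: the contrapositives for the forms of `X_{Γ′}` (zero outside the ball);
**`isPosDefOnHolo_holds`**: for `D` a fundamental domain of `Γ′`, `d.IsPosDefOnHolo Γ' D` — the residual (T1) of
`ConcreteResidual` is a THEOREM.

Nothing here says anything about the status of the Hodge conjecture for CM abelian varieties, which is NOT proved
(HC_CM is NOT proved by anyone in this repository).
-/

set_option autoImplicit false

noncomputable section

open Matrix MeasureTheory NumberField Set
open scoped ComplexConjugate ComplexOrder

namespace Summit.Ventures.HodgeRepro.Tier4

section Field

variable {E : Type} [Field E] [NumberField E] {c : E ≃+* E} {H : Matrix (Fin 3) (Fin 3) E} {τ₀ : E →+* ℂ}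
  {C : Matrix (Fin 3) (Fin 3) ℂ} {Γ' : Set (Matrix (Fin 3) (Fin 3) E)}

/-- **`L²` positivity of a non-zero holomorphic invariant `1`-form over a fundamental domain** (the `1`-form twin
of `setIntegral_normSq_pos`): `G` holomorphic on the ball, `G z = (Dφ(z))ᵀ G (φ z)` for `φ = actM M(γ)`, `γ ∈ Γ′`,
`Σ_i ‖G_i‖²` integrable over `D`, `G` not identically zero on the ball ⟹ `0 < ∫_D Σ_i ‖G_i‖²`. -/
theorem setIntegral_normSq_pos_field (hτ : ∀ x, τ₀ (c x) = conj (τ₀ x)) (hC : IsSylvester (H.map τ₀) C)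
    (hΓ' : IsCongruenceSubgroup c H Γ') {D : Set (Fin 2 → ℂ)} (hD : IsFundamentalDomainFor (ballActions τ₀ C Γ') D)
    {G : (Fin 2 → ℂ) → (Fin 2 → ℂ)} (hG : DifferentiableOn ℂ G ball)
    (hinv : ∀ γ ∈ Γ', ∀ z ∈ ball, pullField (actM (toBallMat τ₀ C γ)) G z = G z)
    (hint : IntegrableOn (fun z => ∑ i, ‖G z i‖ ^ 2) D volume) (hne : ∃ z ∈ ball, G z ≠ 0) :
    0 < ∫ z in D, ∑ i, ‖G z i‖ ^ 2 := by
  obtain ⟨z₀, hz₀, hz₀ne⟩ := hne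
  have hopen : IsOpen ball := isOpen_ball_target
  have hcont : ContinuousAt G z₀ := hG.continuousOn.continuousAt (hopen.mem_nhds hz₀)
  have hev : ∀ᶠ z in nhds z₀, G z ≠ 0 ∧ z ∈ ball := (hcont.eventually_ne hz₀ne).and (hopen.mem_nhds hz₀)
  obtain ⟨U, hUsub, hUopen, hz₀U⟩ := _root_.eventually_nhds_iff.mp hev
  have hUball : U ⊆ ball := fun z hz => (hUsub z hz).2
  have hUne : ∀ z ∈ U, G z ≠ 0 := fun z hz => (hUsub z hz).1
  have hUpos : 0 < volume U := hUopen.measure_pos volume ⟨z₀, hz₀U⟩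
  obtain ⟨φ, hφS, hφpos⟩ := exists_translate_pos (countable_ballActions τ₀ C Γ') hD hUball hUpos
  obtain ⟨γ, hγ, rfl⟩ := hφS
  obtain ⟨δ, hδ, _, hδγ⟩ := hΓ'.exists_inv_mem hγ
  have hγJ : (toBallMat τ₀ C γ)ᴴ * J * toBallMat τ₀ C γ = J := toBallMat_J τ₀ c hτ hC (hΓ'.2.2.2.1 hγ).1
  have hδJ : (toBallMat τ₀ C δ)ᴴ * J * toBallMat τ₀ C δ = J := toBallMat_J τ₀ c hτ hC (hΓ'.2.2.2.1 hδ).1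
  set φ := actM (toBallMat τ₀ C γ) with hφ_def
  set S := U ∩ φ ⁻¹' D with hS_def
  have hSball : S ⊆ ball := fun z hz => hUball hz.1
  have hφmaps : MapsTo φ ball ball := fun z hz => actM_mem_ball hγJ hz
  have himgpos : 0 < volume (φ '' S) :=
    volume_image_pos_of_inverse hφmaps (differentiableOn_actM hδJ)
      (fun z hz => actM_inv_left hτ hC hΓ' hγ hδγ hz) hSball hφpos
  -- `φ '' S ⊆ support (Σ_i ‖G_i‖²) ∩ D`: vanishing at `φ u` would force vanishing at `u`
  have hsub : φ '' S ⊆ Function.support (fun z => ∑ i, ‖G z i‖ ^ 2) ∩ D := by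
    rintro w ⟨u, ⟨huU, huD⟩, rfl⟩
    refine ⟨?_, huD⟩
    have hu : pullField φ G u = G u := hinv γ hγ u (hUball huU)
    have hne' : G (φ u) ≠ 0 := by
      intro h0
      apply hUne u huU
      rw [← hu]
      simp [pullField, h0]
    simp only [Function.mem_support, ne_eq]
    intro hsum
    apply hne'
    have hzero : ∀ i ∈ (Finset.univ : Finset (Fin 2)), ‖G (φ u) i‖ ^ 2 = 0 :=
      (Finset.sum_eq_zero_iff_of_nonneg fun i _ => by positivity).mp hsum
    funext i
    have := hzero i (Finset.mem_univ i)
    simpa using this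
  have hsupp : 0 < volume (Function.support (fun z => ∑ i, ‖G z i‖ ^ 2) ∩ D) :=
    lt_of_lt_of_le himgpos (measure_mono hsub)
  exact (setIntegral_pos_iff_support_of_nonneg_ae
    (Filter.Eventually.of_forall fun z => Finset.sum_nonneg fun i _ => by positivity) hint).mpr hsupp

end Field

/-- `‖h‖²` of a bounded measurable function is integrable on a measurable `D ⊆ 𝔹²`. -/
theorem integrableOn_normSq_of_bdd {D : Set (Fin 2 → ℂ)} (hD : D ⊆ ball) (hDm : MeasurableSet D)
    {h : (Fin 2 → ℂ) → ℂ} (hh : IsBddMeasOn D h) : IntegrableOn (fun z => ‖h z‖ ^ 2) D volume := by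
  obtain ⟨hm, Cb, hC⟩ := hh
  refine ⟨(hm.norm.pow 2), ?_⟩
  refine HasFiniteIntegral.restrict_of_bounded (C := |Cb| ^ 2) (volume_ne_top_of_subset_ball hD).lt_top ?_
  refine ae_restrict_of_forall_mem hDm fun z hz => ?_
  rw [Real.norm_of_nonneg (by positivity)]
  exact pow_le_pow_left₀ (norm_nonneg _) ((hC z hz).trans (le_abs_self Cb)) 2

/-- `Σ_i ‖G_i‖²` of a bounded measurable field is integrable on a measurable `D ⊆ 𝔹²`. -/
theorem integrableOn_normSq_field_of_bdd {D : Set (Fin 2 → ℂ)} (hD : D ⊆ ball) (hDm : MeasurableSet D)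
    {G : (Fin 2 → ℂ) → (Fin 2 → ℂ)} (hG : IsBddMeasOn D G) : IntegrableOn (fun z => ∑ i, ‖G z i‖ ^ 2) D volume :=
  integrable_finsetSum _ fun i _ => integrableOn_normSq_of_bdd hD hDm (hG.apply i)

namespace TargetData

variable {F E : Type} [Field F] [NumberField F] [IsGalois ℚ F] [IsCMField F]
  [Field E] [NumberField E] [IsGalois ℚ E] [IsCMField E] (d : TargetData F E)

/-- A holomorphic bounded measurable `2`-form of `X_{Γ′}` with `∫_D h · conj h = 0` is zero (`D` a fundamental
domain of `Γ′`). -/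
theorem eq_zero_of_integral_eq_zero_2 {Γ' : Set (Matrix (Fin 3) (Fin 3) E)} (hΓ' : d.IsLevel Γ')
    {D : Set (Fin 2 → ℂ)} (hDom : d.IsDomain Γ' D) {h : (Fin 2 → ℂ) → ℂ} (hA : d.IsAutForm2 Γ' h)
    (hH : IsHolo2 h) (hB : IsBddMeasOn D h) (h0 : (∫ z in D, h z * conj (h z)) = 0) : h = 0 := by
  have hD : D ⊆ ball := hDom.subset_ball
  have hDm : MeasurableSet D := hDom.measurableSet
  by_contra hne
  have hne' : ∃ z ∈ ball, h z ≠ 0 := by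
    by_contra hall
    apply hne
    funext z
    by_cases hz : z ∈ ball
    · by_contra hz0
      exact hall ⟨z, hz, hz0⟩
    · exact hA.1 z hz
  have hpos := setIntegral_normSq_pos (complexConj_intertwines E d.τ₀) d.hC hΓ'.congr hDom
    (h := h) hH (fun γ hγ z hz => hA.2 γ hγ z hz) (integrableOn_normSq_of_bdd hD hDm hB) hne'
  rw [integral_mul_conj_self] at h0
  have h0' : (∫ z in D, Complex.normSq (h z)) = 0 := by exact_mod_cast h0
  have : (∫ z in D, ‖h z‖ ^ 2) = ∫ z in D, Complex.normSq (h z) := by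
    congr 1
    funext z
    rw [Complex.normSq_eq_norm_sq]
  rw [this, h0'] at hpos
  exact lt_irrefl _ hpos

/-- A holomorphic bounded measurable `1`-form of `X_{Γ′}` with `∫_D Σ_i G_i · conj G_i = 0` is zero. -/
theorem eq_zero_of_integral_eq_zero_1 {Γ' : Set (Matrix (Fin 3) (Fin 3) E)} (hΓ' : d.IsLevel Γ')
    {D : Set (Fin 2 → ℂ)} (hDom : d.IsDomain Γ' D) {G : (Fin 2 → ℂ) → (Fin 2 → ℂ)} (hA : d.IsAutForm1 Γ' G)
    (hH : IsHolo1 G) (hB : IsBddMeasOn D G) (h0 : (∫ z in D, ∑ i, G z i * conj (G z i)) = 0) : G = 0 := by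
  have hD : D ⊆ ball := hDom.subset_ball
  have hDm : MeasurableSet D := hDom.measurableSet
  by_contra hne
  have hne' : ∃ z ∈ ball, G z ≠ 0 := by
    by_contra hall
    apply hne
    funext z
    by_cases hz : z ∈ ball
    · by_contra hz0
      exact hall ⟨z, hz, hz0⟩
    · exact hA.1 z hz
  have hpos := setIntegral_normSq_pos_field (complexConj_intertwines E d.τ₀) d.hC hΓ'.congr hDom
    (G := G) hH (fun γ hγ z hz => hA.2 γ hγ z hz) (integrableOn_normSq_field_of_bdd hD hDm hB) hne'
  rw [integral_inner_self] at h0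
  have h0' : (∫ z in D, ∑ i, Complex.normSq (G z i)) = 0 := by exact_mod_cast h0
  have : (∫ z in D, ∑ i, ‖G z i‖ ^ 2) = ∫ z in D, ∑ i, Complex.normSq (G z i) := by
    congr 1
    funext z
    refine Finset.sum_congr rfl fun i _ => ?_
    rw [Complex.normSq_eq_norm_sq]
  rw [this, h0'] at hpos
  exact lt_irrefl _ hpos

/-- **(T1) HOLDS**: the pairing is positive definite on the holomorphic concrete forms of `X_{Γ′}` over a
fundamental domain `D` of `Γ′`. -/
theorem isPosDefOnHolo_holds {Γ' : Set (Matrix (Fin 3) (Fin 3) E)} (hΓ' : d.IsLevel Γ') {D : Set (Fin 2 → ℂ)}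
    (hDom : d.IsDomain Γ' D) : d.IsPosDefOnHolo Γ' D :=
  d.isPosDefOnHolo_of Γ' D (fun _ hA hH hB h0 => d.eq_zero_of_integral_eq_zero_1 hΓ' hDom hA hH hB h0)
    (fun _ hA hH hB h0 => d.eq_zero_of_integral_eq_zero_2 hΓ' hDom hA hH hB h0)

end TargetData

end Summit.Ventures.HodgeRepro.Tier4
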